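import Summits.HodgeConjecture.HodgeConjecture.Theses.BoundaryReadout
import Literature.AlgebraicGeometry.Motives.CyclesBaseChange
import Literature.AlgebraicGeometry.Motives.CurveNet
import HarnessLib

/-!
# Route `BoundaryReadout` — crux `BoundaryAbsoluteness` (stmt-HodgeConjecture-15913), line
# `typewise_readout`, stub `stub_conjugateFibre`: conjugation commutes with fibres and coverings

Helper file for the crux item stmt-HodgeConjecture-15913 (`--supports`; it closes nothing): it proves
the registered stub `stub_conjugateFibre` of the skeleton
`Cruxes/BoundaryAbsoluteness/Lines/typewise_readout.lean`, verbatim. It is pure base-change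
bookkeeping along a field automorphism `σ ∈ Aut ℂ` (Hartshorne II.3, fibre products and base
extension), with no Hodge theory:

* (i) for `f : 𝒳 ⟶ C` over `ℂ` and a point `t ∈ C(ℂ)`, the conjugate `(X_t)^σ` of the fibre is a
  fibre of the conjugate family `f^σ : 𝒳^σ ⟶ C^σ`, over the point `t' := σ(t) ∈ C^σ(ℂ)`, compatibly
  with the fibre inclusions;
* (ii) conjugation preserves joint surjectivity (on scheme points) of a family `g_i : Y_i ⟶ X`.

## Proof

(i) The squares `Z^σ ⟶ Z` over `W^σ ⟶ W` attached to a `ℂ`-morphism `Z ⟶ W` are cartesian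
(`Motives.isPullback_baseChangeHom_map_left`). Pasting the one for the fibre inclusion
`X_t ⟶ 𝒳` with the fibre square `X_t = 𝒳 ×_C Spec ℂ` and un-pasting the one for `t : Spec ℂ ⟶ C`
shows that `(X_t)^σ` is the fibre product of `f^σ` and `t^σ : (Spec ℂ)^σ ⟶ C^σ`; finally
`(Spec ℂ)^σ ≅ Spec ℂ` over `ℂ` (its structure map is the pullback of the isomorphism
`Spec ℂ ⟶ Spec ℂ`), and `t'` is `t^σ` transported along this isomorphism.

(ii) For `x' ∈ X^σ` over `x ∈ X`, pick `g_i(y) = x`; since `Y_i^σ = Y_i ×_X X^σ`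
(`isPullback_baseChangeHom_map_left`), a point `y' ∈ Y_i^σ` over `(y, x')` exists
(`Scheme.exists_preimage_of_isPullback`).

## Main result

* `stub_conjugateFibre` — the registered stub (name and signature verbatim), PROVED (standard axioms).

## References

* R. Hartshorne, *Algebraic Geometry*, GTM 52 (1977), II.3 (fibre products, base extension, fibres
  of a morphism).
-/

-- every declaration of this problem lives in `Summit.HodgeConjecture.HodgeConjecture.…`
-- (single-problem summit: Problem = Summit), which `linter.dupNamespace` flags; set so that
-- stand-alone elaboration is warning-free.
set_option linter.dupNamespace false

noncomputable section

namespace Summit.HodgeConjecture.HodgeConjecture.Theorems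

open CategoryTheory CategoryTheory.Limits AlgebraicGeometry
open Literature.AlgebraicGeometry.Motives Literature.AlgebraicGeometry.HodgeTheory

namespace BoundaryAbsolutenessConjugateFibre

universe u

variable {K L : Type u} [Field K] [Field L] (σ : K →+* L)

/-- **Base change of a fibre square.** For a `K`-morphism `f : 𝒳 ⟶ S`, a `K`-rational point
`t : Spec K ⟶ S` and a field homomorphism `σ : K →+* L`, the base change `(𝒳_t)_σ` of the fibre is
the fibre product of `f_σ : 𝒳_σ ⟶ S_σ` and `t_σ : (Spec K)_σ ⟶ S_σ`, with projections the base
changes of the fibre inclusion and of the structure map of the fibre (paste `(𝒳_t)_σ = 𝒳_σ ×_𝒳 𝒳_t`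
with `𝒳_t = 𝒳 ×_S Spec K`, then un-paste `(Spec K)_σ = S_σ ×_S Spec K`; Hartshorne II.3).
[folklore] -/
theorem isPullback_baseChangeHom_map_fiberι {𝒳 S : SchemeOver K} (f : 𝒳 ⟶ S) (t : AlgPoints S K) :
    IsPullback ((baseChangeHom σ).map (fiberι f t)).left
      ((baseChangeHom σ).map (fiberOverToSpec f t)).left
      ((baseChangeHom σ).map f).left ((baseChangeHom σ).map t).left := by
  have sqι := isPullback_baseChangeHom_map_left σ (fiberι f t)
  have sqt := isPullback_baseChangeHom_map_left σ t
  have s : IsPullback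
      (((baseChangeHom σ).map (fiberOverToSpec f t)).left ≫ baseChangeHomFst σ (specOver K K))
      ((baseChangeHom σ).map (fiberι f t)).left t.left
      (((baseChangeHom σ).map f).left ≫ baseChangeHomFst σ S) := by
    rw [baseChangeHom_map_left_comp_fst, baseChangeHom_map_left_comp_fst]
    exact sqι.paste_horiz (IsPullback.of_hasPullback f.left t.left).flip
  have p : ((baseChangeHom σ).map (fiberOverToSpec f t)).left ≫ ((baseChangeHom σ).map t).left =
      ((baseChangeHom σ).map (fiberι f t)).left ≫ ((baseChangeHom σ).map f).left := by
    simp only [← Over.comp_left, ← Functor.map_comp, fiberι_comp]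
  exact (s.of_right p sqt).flip

/-- **`(Spec K)_σ ≅ Spec L` over `L`**: the structure map `(Spec K)_σ ⟶ Spec L` is the pullback of
the isomorphism `Spec K ⟶ Spec K` (`CurveNet.isIso_specOver_self_hom`) along `Spec σ`, hence an
isomorphism, and it is (tautologically) a morphism over `Spec L` (Hartshorne II.3, II Ex. 2.7).
[folklore] -/
theorem nonempty_baseChangeHom_specOver_iso :
    Nonempty ((baseChangeHom σ).obj (specOver K K) ≅ specOver L L) := by
  haveI := CurveNet.isIso_specOver_self_hom K
  have hL : (specOver L L).hom = 𝟙 (Spec (CommRingCat.of L)) := by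
    change Spec.map (CommRingCat.ofHom (algebraMap L L)) = 𝟙 _
    rw [Algebra.algebraMap_self, CommRingCat.ofHom_id, Spec.map_id]
  -- the isomorphism `(Spec K)_σ ≅ Spec L` of underlying schemes, elaborated against a syntactically
  -- canonical type (not against `(_)_σ.left ≅ (specOver L L).left`, which would instantiate the implicit
  -- objects of `pullback.snd` in a form the `IsIso` instance does not match)
  obtain ⟨u, hu⟩ :
      ∃ u : pullback (specOver K K).hom (Spec.map (CommRingCat.ofHom σ)) ≅ Spec (.of L),
        u.hom = pullback.snd (specOver K K).hom (Spec.map (CommRingCat.ofHom σ)) :=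
    ⟨asIso (pullback.snd (specOver K K).hom (Spec.map (CommRingCat.ofHom σ))), rfl⟩
  refine ⟨Over.isoMk u ?_⟩
  rw [hu]
  exact (congrArg (pullback.snd _ _ ≫ ·) hL).trans (Category.comp_id _)

end BoundaryAbsolutenessConjugateFibre

open BoundaryAbsolutenessConjugateFibre in
/-- **Registered stub `stub_conjugateFibre`** (line `typewise_readout` of the crux
`BoundaryAbsoluteness`, statement verbatim): (i) the conjugate of a fibre is a fibre of the conjugate
family, compatibly with the fibre inclusions — for `f : 𝒳 ⟶ C` over `ℂ`, `σ ∈ Aut ℂ` and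
`t ∈ C(ℂ)` there are `t' ∈ C^σ(ℂ)` and `e : (X_t)^σ ≅ (𝒳^σ)_{t'}` over `ℂ` with
`e ≫ ι_{t'} = (ι_t)^σ`; (ii) conjugation preserves joint surjectivity on scheme points of a family
`g_i : Y_i ⟶ X` (the squares `Y_i^σ ⟶ Y_i` over `X^σ ⟶ X` are cartesian and points of a fibre
product with prescribed compatible images exist). Base-change bookkeeping (Hartshorne II.3).
[folklore] -/
theorem stub_conjugateFibre :
    (∀ ⦃𝒳 C : SchemeOver ℂ⦄ (f : 𝒳 ⟶ C) (σ : ℂ ≃+* ℂ) (t : AlgPoints C ℂ),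
        ∃ (t' : AlgPoints (conjugateVariety σ C) ℂ)
          (e : conjugateVariety σ (fiberOver f t) ≅ fiberOver (conjHom σ f) t'),
          e.hom ≫ fiberι (conjHom σ f) t' = conjHom σ (fiberι f t)) ∧
    (∀ ⦃X : SchemeOver ℂ⦄ ⦃ι : Type⦄ ⦃Y : ι → SchemeOver ℂ⦄ (g : ∀ i, Y i ⟶ X) (σ : ℂ ≃+* ℂ),
        (∀ x : ↥X.left, ∃ (i : ι) (y : ↥(Y i).left), (g i).left.base y = x) →
        ∀ x' : ↥(conjugateVariety σ X).left,
          ∃ (i : ι) (y' : ↥(conjugateVariety σ (Y i)).left), (conjHom σ (g i)).left.base y' = x') := by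
  refine ⟨fun 𝒳 C f σ t => ?_, fun X ι Y g σ hg x' => ?_⟩
  · -- (i) the conjugate fibre is a fibre of the conjugate family
    obtain ⟨eSpec⟩ := nonempty_baseChangeHom_specOver_iso (K := ℂ) (L := ℂ) σ.toRingHom
    have T := isPullback_baseChangeHom_map_fiberι σ.toRingHom f t
    have T' : IsPullback (conjHom σ (fiberι f t)).left
        (conjHom σ (fiberOverToSpec f t) ≫ eSpec.hom).left (conjHom σ f).left
        (eSpec.inv ≫ conjHom σ t).left :=
      T.of_iso (Iso.refl _) (Iso.refl _) ((Over.forget _).mapIso eSpec) (Iso.refl _)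
        ((Category.comp_id _).trans (Category.id_comp _).symm) (Category.id_comp _).symm
        ((Category.comp_id _).trans (Category.id_comp _).symm) (by
          change _ ≫ 𝟙 _ = eSpec.hom.left ≫ (eSpec.inv ≫ conjHom σ t).left
          rw [Category.comp_id, Over.comp_left, Over.hom_left_inv_left_assoc])
    refine ⟨eSpec.inv ≫ conjHom σ t, Over.isoMk T'.isoPullback ?_, ?_⟩
    · change T'.isoPullback.hom ≫ (pullback.fst _ _ ≫ _) = _
      rw [T'.isoPullback_hom_fst_assoc]
      exact Over.w (conjHom σ (fiberι f t))
    · ext : 1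
      simp
  · -- (ii) conjugation preserves joint surjectivity on points
    obtain ⟨i, y, hy⟩ := hg ((baseChangeHomFst σ.toRingHom X).base x')
    obtain ⟨y', -, hy'⟩ := Scheme.exists_preimage_of_isPullback
      (isPullback_baseChangeHom_map_left σ.toRingHom (g i)) y x' hy
    exact ⟨i, y', hy'⟩

end Summit.HodgeConjecture.HodgeConjecture.Theorems

end
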